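import Summits.SmoothPoincare4.SmoothPoincare4.Theorems.ConvexBisectionAcyclicBisectionExistsStabilisationData
import HarnessLib

/-!
# N3 (`stub_STgeo`) ▸ N3-nat ▸ piece N3d-2 `node_cancel`: THE CONTRACT — the cancellation of the two
# `(1,2)`-pairs of the stabilised base from ONE general theorem (simultaneous cancellation of disjoint
# `(1,2)`-pairs in Kosinski's language), kernel-checked
(wave 8, brick J7-3 of stub `stub_STgeo` = node N3 of NF4, line `modp-braid-orbits`, crux
`ConvexBisection.AcyclicBisectionExists`, item stmt-SmoothPoincare4-10508; registered sub-goal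
`helper_node_cancel_of_cancelPairs`; design file `work/design/N3d_Pieces_Design.lean` (J7, wave 8) §C; the
piece text is the hypothesis `h2` of `StabilisationData.node_STnat_of_pieces` (`…StabilisationAngles.lean`, H6).)

The general theorem (sub-piece `piece2_cancelPairs`, text `work/stubs/sig_piece2_cancelPairs.txt`): for a
compact 4-manifold `M`, a finite family `q1` of 1-handle maps with attachment `N` (data `E`), a family `q2`
of 2-handle maps on `N` indexed by the same type with attachment `V` (data `DV`), such that the attaching
circle of `q2 i` crosses the belt sphere of the 1-handle `i` exactly once transversally in model position
(`crossVec`) and misses the other belt spheres, there is `Λ : V ≅ M` equal to the canonical identification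
at every point of `M` off the ranges of the `q1 i` whose image is off the ranges of the `q2 i` (Kosinski
1993 VI (7.4); no neighbourhood is needed: room is made by shrinking the tubes, locality on data,
`…StabDataLocality.lean`).  `node_cancel_of_subpieces` instantiates it at `M := Base g`, `q1 := S.q1`,
`N := Base (g+1)`, `E := S.E`, `q2 := ![S.qA, S.qB]` (crossing data `S.A_cross`, `S.B_cross` through
`S.qA_circle`, `S.qB_circle`; a point off the model region is off the 1-handle ranges by `S.range_q1`, its
image off the block ranges by `S.range_qA/qB` + `S.model_pullback`).  No definitions.
References: A. A. Kosinski, *Differential Manifolds* (1993), VI (7.4) [Kosinski1993]; J. Milnor, *Lectures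
on the h-cobordism theorem* (1965), Thm. 5.4 [MilnorHCobordism1965].
-/

noncomputable section

-- the prescribed namespace `Summit.<P>.<Sub>.…` duplicates `SmoothPoincare4` (P = Sub)
set_option linter.dupNamespace false

open scoped Manifold ContDiff Topology Real
open Set Function

namespace Summit.SmoothPoincare4.SmoothPoincare4.Theorems.AcyclicBisectionExists.ModpBraidOrbits

open Literature.GroupTheory.CombinatorialGroupTheory.SignedHurwitz
open Literature.Topology.FourManifolds Literature.Topology.FourManifolds.LefschetzBase
open Literature.Topology.FourManifolds.HandleAttachingMap
open Literature.Geometry.Symplectic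

namespace StabCancelContract

/-- **CONTRACT N3d-2: `node_cancel` (text of `work/stubs/sig_node_cancel.txt`) from (C1)** — PROVED:
`M := Base g`, `q1 := S.q1`, `N := Base (g+1)`, `E := S.E`, `q2 := ![S.qA, S.qB]`; the crossing data
are `S.A_cross`, `S.B_cross` through `S.qA_circle`, `S.qB_circle`; a point off the model region is off
the 1-handle ranges (`S.range_q1`) and its image is off the block ranges (`S.range_qA/qB`,
`S.model_pullback`). [cite: Kosinski1993, VI (7.4)] -/
theorem node_cancel_of_subpieces
    (hC : ∀ (M : Type) [TopologicalSpace M] [T2Space M] [SecondCountableTopology M] [CompactSpace M]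
      [ChartedSpace (EuclideanHalfSpace 4) M] [IsManifold (𝓡∂ 4) ∞ M]
      (ι : Type) [Finite ι] (q1 : ι → HandleAttachingMap 3 1 M)
      (N : Type) [TopologicalSpace N] [T2Space N] [SecondCountableTopology N] [CompactSpace N]
      [ChartedSpace (EuclideanHalfSpace 4) N] [IsManifold (𝓡∂ 4) ∞ N]
      (E : MultiAttachmentData q1 (𝓡∂ 4) N) (q2 : ι → HandleAttachingMap 3 2 N)
      (V : Type) [TopologicalSpace V] [T2Space V] [SecondCountableTopology V] [CompactSpace V]
      [ChartedSpace (EuclideanHalfSpace 4) V] [IsManifold (𝓡∂ 4) ∞ V]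
      (DV : MultiAttachmentData q2 (𝓡∂ 4) V),
      (∀ i, ∃ (t₀ : ℝ) (u : EuclideanSpace ℝ (Fin 3)) (ε : ℝ), ‖u‖ = 1 ∧ 0 < ε ∧
        (∀ s ∈ Ioo (-ε) ε, ∃ b : ↥(beltPiece 3 1), (b.1.1 : EuclideanSpace ℝ (Fin 4)) = crossVec u s ∧
          (q2 i).attachingCircle (circlePt (t₀ + s)) = E.jB i b) ∧
        (∀ (θ : Metric.sphere (0 : EuclideanSpace ℝ (Fin 2)) 1) (b : ↥(beltPiece 3 1)),
          lamSq 1 (b.1.1 : EuclideanSpace ℝ (Fin 4)) = 0 → (q2 i).attachingCircle θ = E.jB i b →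
            θ = circlePt t₀) ∧
        (∀ j, j ≠ i → ∀ (θ : Metric.sphere (0 : EuclideanSpace ℝ (Fin 2)) 1) (b : ↥(beltPiece 3 1)),
          lamSq 1 (b.1.1 : EuclideanSpace ℝ (Fin 4)) = 0 → (q2 i).attachingCircle θ ≠ E.jB j b)) →
      ∃ Λ : V ≃ₘ⟮𝓡∂ 4, 𝓡∂ 4⟯ M,
        ∀ (a : ↥(coresComplement q1)) (ha : E.jA a ∈ coresComplement q2),
          (∀ i y, (q1 i).toFun y ≠ (a : M)) → (∀ i y, (q2 i).toFun y ≠ E.jA a) →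
          Λ (DV.jA ⟨E.jA a, ha⟩) = (a : M)) :
    ∀ (g n : ℕ) (c : Fin g ⊕ Fin g → ℤ) (S : StabBaseData g n c)
      (V : Type) [TopologicalSpace V] [T2Space V] [SecondCountableTopology V] [CompactSpace V]
      [ChartedSpace (EuclideanHalfSpace 4) V] [IsManifold (𝓡∂ 4) ∞ V]
      (DV : MultiAttachmentData ![S.qA, S.qB] (𝓡∂ 4) V),
      ∃ Λ : V ≃ₘ⟮𝓡∂ 4, 𝓡∂ 4⟯ Base g,
        ∀ (a : ↥(coresComplement S.q1)) (ha : S.E.jA a ∈ coresComplement ![S.qA, S.qB]),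
          (a : Base g) ∉ modelRegion g n S.δ₀ S.ε₁ → Λ (DV.jA ⟨S.E.jA a, ha⟩) = (a : Base g) := by
  intro g n c S V _ _ _ _ _ _ DV
  have hcross : ∀ i : Fin 2, ∃ (t₀ : ℝ) (u : EuclideanSpace ℝ (Fin 3)) (ε : ℝ), ‖u‖ = 1 ∧ 0 < ε ∧
      (∀ s ∈ Ioo (-ε) ε, ∃ b : ↥(beltPiece 3 1), (b.1.1 : EuclideanSpace ℝ (Fin 4)) = crossVec u s ∧
        (![S.qA, S.qB] i).attachingCircle (circlePt (t₀ + s)) = S.E.jB i b) ∧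
      (∀ (θ : Metric.sphere (0 : EuclideanSpace ℝ (Fin 2)) 1) (b : ↥(beltPiece 3 1)),
        lamSq 1 (b.1.1 : EuclideanSpace ℝ (Fin 4)) = 0 → (![S.qA, S.qB] i).attachingCircle θ = S.E.jB i b →
          θ = circlePt t₀) ∧
      (∀ j, j ≠ i → ∀ (θ : Metric.sphere (0 : EuclideanSpace ℝ (Fin 2)) 1) (b : ↥(beltPiece 3 1)),
        lamSq 1 (b.1.1 : EuclideanSpace ℝ (Fin 4)) = 0 → (![S.qA, S.qB] i).attachingCircle θ ≠ S.E.jB j b) := by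
    intro i
    fin_cases i
    · obtain ⟨t₀, u, ε, hu, hε, h1, h2, h3⟩ := S.A_cross
      refine ⟨t₀, u, ε, hu, hε, ?_, ?_, ?_⟩
      · simpa [S.qA_circle] using h1
      · simpa [S.qA_circle] using h2
      · intro j hj θ b hb
        fin_cases j
        · exact absurd rfl hj
        · simpa [S.qA_circle] using h3 θ b hb
    · obtain ⟨t₀, u, ε, hu, hε, h1, h2, h3⟩ := S.B_cross
      refine ⟨t₀, u, ε, hu, hε, ?_, ?_, ?_⟩
      · simpa [S.qB_circle] using h1
      · simpa [S.qB_circle] using h2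
      · intro j hj θ b hb
        fin_cases j
        · simpa [S.qB_circle] using h3 θ b hb
        · exact absurd rfl hj
  obtain ⟨Λ, hΛ⟩ := hC (Base g) (Fin 2) S.q1 (Base (g + 1)) S.E ![S.qA, S.qB] V DV hcross
  refine ⟨Λ, fun a ha hmod => hΛ a ha (fun i y he => hmod ?_) (fun i y he => hmod ?_)⟩
  · rw [← he]; exact (S.range_q1 i y).1
  · refine S.model_pullback a ?_
    fin_cases i
    · have he' : S.qA.toFun y = S.E.jA a := by simpa using he
      rw [← he']; exact (S.range_qA y).1
    · have he' : S.qB.toFun y = S.E.jA a := by simpa using he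
      rw [← he']; exact (S.range_qB y).1

end StabCancelContract

/-! ## Registered helper -/

/-- **Registered helper `helper_node_cancel_of_cancelPairs` (sub-goal of `stub_STgeo` ▸ N3-nat ▸ N3d-2, wave
8, lead c5): N3d-2 `node_cancel` from the general simultaneous cancellation of disjoint `(1,2)`-pairs.**
[cite: Kosinski1993, VI (7.4)] -/
theorem helper_node_cancel_of_cancelPairs : (∀ (M : Type) [TopologicalSpace M] [T2Space M] [SecondCountableTopology M] [CompactSpace M] [ChartedSpace (EuclideanHalfSpace 4) M] [IsManifold (𝓡∂ 4) ∞ M] (ι : Type) [Finite ι] (q1 : ι → Literature.Topology.FourManifolds.HandleAttachingMap 3 1 M) (N : Type) [TopologicalSpace N] [T2Space N] [SecondCountableTopology N] [CompactSpace N] [ChartedSpace (EuclideanHalfSpace 4) N] [IsManifold (𝓡∂ 4) ∞ N] (E : Literature.Topology.FourManifolds.HandleAttachingMap.MultiAttachmentData q1 (𝓡∂ 4) N) (q2 : ι → Literature.Topology.FourManifolds.HandleAttachingMap 3 2 N) (V : Type) [TopologicalSpace V] [T2Space V] [SecondCountableTopology V] [CompactSpace V] [ChartedSpace (EuclideanHalfSpace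 4) V] [IsManifold (𝓡∂ 4) ∞ V] (DV : Literature.Topology.FourManifolds.HandleAttachingMap.MultiAttachmentData q2 (𝓡∂ 4) V), (∀ i, ∃ (t₀ : ℝ) (u : EuclideanSpace ℝ (Fin 3)) (ε : ℝ), ‖u‖ = 1 ∧ 0 < ε ∧ (∀ s ∈ Set.Ioo (-ε) ε, ∃ b : ↥(Literature.Topology.FourManifolds.beltPiece 3 1), (b.1.1 : EuclideanSpace ℝ (Fin 4)) = Summit.SmoothPoincare4.SmoothPoincare4.Theorems.AcyclicBisectionExists.ModpBraidOrbits.crossVec u s ∧ (q2 i).attachingCircle (Literature.Topology.FourManifolds.circlePt (t₀ + s)) = E.jB i b) ∧ (∀ (θ : Metric.sphere (0 : EuclideanSpace ℝ (Fin 2)) 1) (b : ↥(Literature.Topology.FourManifolds.beltPiece 3 1)), Literature.Topology.FourManifolds.lamSq 1 (b.1.1 : EuclideanSpace ℝ (Fin 4)) = 0 → (q2 i).attachingCircle θ = E.jB i b → θ = Literature.Topology.FourManifolds.circlePt t₀) ∧ (∀ j, j ≠ i → ∀ (θ : Metric.sphere (0 : EuclideanSpace ℝ (Fin 2)) 1)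 (b : ↥(Literature.Topology.FourManifolds.beltPiece 3 1)), Literature.Topology.FourManifolds.lamSq 1 (b.1.1 : EuclideanSpace ℝ (Fin 4)) = 0 → (q2 i).attachingCircle θ ≠ E.jB j b)) → ∃ Λ : V ≃ₘ⟮𝓡∂ 4, 𝓡∂ 4⟯ M, ∀ (a : ↥(Literature.Topology.FourManifolds.HandleAttachingMap.coresComplement q1)) (ha : E.jA a ∈ Literature.Topology.FourManifolds.HandleAttachingMap.coresComplement q2), (∀ i y, (q1 i).toFun y ≠ (a : M)) → (∀ i y, (q2 i).toFun y ≠ E.jA a) → Λ (DV.jA ⟨E.jA a, ha⟩) = (a : M)) → ∀ (g n : ℕ) (c : Fin g ⊕ Fin g → ℤ) (S : Summit.SmoothPoincare4.SmoothPoincare4.Theorems.AcyclicBisectionExists.ModpBraidOrbits.StabBaseData g n c) (V : Type) [TopologicalSpace V] [T2Space V] [SecondCountableTopology V] [CompactSpace V] [ChartedSpace (EuclideanHalfSpace 4) V] [IsManifold (𝓡∂ 4) ∞ V] (DV : Literature.Topology.FourManifolds.HandleAttachingMap.MultiAttachmentData ![S.qA, S.qB] (𝓡∂ 4) V), ∃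 Λ : V ≃ₘ⟮𝓡∂ 4, 𝓡∂ 4⟯ Literature.Topology.FourManifolds.LefschetzBase.Base g, ∀ (a : ↥(Literature.Topology.FourManifolds.HandleAttachingMap.coresComplement S.q1)) (ha : S.E.jA a ∈ Literature.Topology.FourManifolds.HandleAttachingMap.coresComplement ![S.qA, S.qB]), (a : Literature.Topology.FourManifolds.LefschetzBase.Base g) ∉ Summit.SmoothPoincare4.SmoothPoincare4.Theorems.AcyclicBisectionExists.ModpBraidOrbits.modelRegion g n S.δ₀ S.ε₁ → Λ (DV.jA ⟨S.E.jA a, ha⟩) = (a : Literature.Topology.FourManifolds.LefschetzBase.Base g) :=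
  fun hC => StabCancelContract.node_cancel_of_subpieces hC

end Summit.SmoothPoincare4.SmoothPoincare4.Theorems.AcyclicBisectionExists.ModpBraidOrbits

end
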